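import Mathlib.Data.Set.Finite.List
import Literature.Computability.Complexity.UniversalWitnessCircuits
import Literature.Computability.Complexity.EasyWitnessProofs
import HarnessLib

/-!
# Universal witness circuits: hard inputs at infinitely many lengths, and Thm. 5.2 from three leaves

Supplement to `UniversalWitnessCircuits.lean`, which opens Williams' Thm. 5.2
(`Williams2014_thm_5_2`: "If `NEXP ⊆ P/poly` then every language in `NEXP` has universal witness
circuits of polynomial size") along its printed proof (Williams 2010, Appendix A) into the
derandomization leaf `Williams2010_MA_io_of_not_witnessCircuits` and the three easy-witness leaves
of `EasyWitness.lean`, and proves the assembly `Williams2014_thm_5_2_of_components`. Two things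
are added here, both PROVED:

* `NVerifier.not_hasWitnessCircuits_iff_frequently` — the hypothesis of the derandomization leaf,
  `¬ V.HasWitnessCircuits` ("`V` has no witness circuits of polynomial size": for every `d` SOME
  `x ∈ L` has no accepted witness encoded by a `B₂`-circuit with `≤ |x|ᵈ + d` gates), is
  EQUIVALENT to the printed hypothesis shape — Williams 2010, App. A: "for all constants `d ≥ 1`,
  there is an infinite sequence of inputs" with only hard accepted witnesses; IKW 2002, Thm. 12 (2):
  "for every `d ∈ ℕ` and infinitely many `n ∈ ℕ`" — namely: for every `d`, at infinitely many
  lengths `n` (`∃ᶠ n in atTop`) there is an `x ∈ L` of length `n` all of whose accepted witnesses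
  are `d`-hard. The docstrings of the leaf argue this informally; the proof is the absorption of the
  finitely many short members of `L` into the exponent, using correctness of `V` and
  `exists_isPrefix_truthTable` (every string is a prefix of the truth table of some `B₂`-circuit:
  pad to length `2^{|y|}` and realise the table, `cktSize_univ`);
* `Williams2014_thm_5_2_of_leaves`, `Williams2014_thm_5_1_of_leaves` — the assemblies with IKW's
  Thm. 2 discharged by the tree's theorem `IKW2002_thm2_holds` (`EasyWitnessProofs.lean`, Kannan's
  diagonal language is hard almost everywhere and lies in `Σ₄ᵖ ⊆ EXP`), so that the remaining trust
  base of `Williams2014_thm_5_2` and `Williams2014_thm_5_1` is exactly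
  {`EXP_eq_MA_of_subset_PPoly`, `Williams2010_MA_io_of_not_witnessCircuits`, `IKW2002_lemma5`}.

Nothing here duplicates Mathlib (no complexity classes there) or the tree (searched
`iff_frequently`, `isPrefix_truthTable`, `of_leaves`; the `Iff.rfl` unfolding
`hasUniversalWitnessCircuits_iff` and the leaf live in `UniversalWitnessCircuits.lean`).

## References

* R. Williams, *Nonuniform ACC circuit lower bounds*, J. ACM 61 (2014) 2:1–2:32, §5, Thm. 5.1,
  Thm. 5.2 (p. 17) [Williams2014] (held: `paper:doi-10-1145-2559903`).
* R. Williams, *Improving exhaustive search implies superpolynomial lower bounds*, STOC 2010,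
  231–240, Def. 3.2, Lemma 3.1, Appendix A (proof of Lemma 3.1) [Williams2010STOC] (held:
  `paper:doi-10-1145-1806689-1806723`, pp. 10 and 26 of the held text).
* R. Impagliazzo, V. Kabanets, A. Wigderson, *In search of an easy witness: exponential time vs.
  probabilistic polynomial time*, JCSS 65 (2002) 672–694, Thm. 2, Lemma 5, Thm. 12 (2), Lemma 17,
  Thm. 22, Thm. 31 [ImpagliazzoKabanetsWigderson2002] (held:
  `paper:doi-10-1016-s0022-0000-02-00024-7`).
* S. Arora, B. Barak, *Computational Complexity: A Modern Approach*, CUP 2009, Claim 2.13 (every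
  function has a circuit) [AroraBarakCC2009].
-/

noncomputable section

namespace Literature.Computability.Complexity

open Filter

/-! ### Every string is encoded by some circuit -/

/-- Every string is a prefix of the truth table of some `B₂`-circuit: pad `y` with zeros to length
`2^{|y|}` and take any `B₂`-circuit for that table (`cktSize_univ`; Arora–Barak 2009, Claim 2.13:
every Boolean function has a circuit). Hence finitely many inputs always have witness circuits of
SOME size. [cite: AroraBarakCC2009, Claim 2.13] -/
theorem exists_isPrefix_truthTable (y : List Bool) :
    ∃ (m : ℕ) (W : Circuit (Fin m)), W.IsOver B2 ∧ y <+: MetaComplexity.truthTable W.eval := by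
  have hy : y.length ≤ 2 ^ y.length := (Nat.lt_two_pow_self).le
  set t : List Bool := y ++ List.replicate (2 ^ y.length - y.length) false with ht_def
  have ht : t.length = 2 ^ y.length := by
    simp only [ht_def, List.length_append, List.length_replicate]
    omega
  obtain ⟨C, hB, -, hC⟩ :=
    (cktSize_univ fun (v : Fin y.length → Bool) (_ : Unit) =>
      MetaComplexity.ofTruthTable t ht v).toCircuit
  refine ⟨y.length, C, hB, ?_⟩
  have hCe : C.eval = MetaComplexity.ofTruthTable t ht := funext hC
  rw [hCe, MetaComplexity.truthTable_ofTruthTable]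
  exact List.prefix_append _ _

/-- `nᵈ + d` is monotone in the exponent-and-constant `d` (also at `n = 0`, where `0⁰ = 1`).
[folklore] -/
theorem pow_add_self_mono (n : ℕ) {d D : ℕ} (h : d ≤ D) : n ^ d + d ≤ n ^ D + D := by
  rcases Nat.eq_zero_or_pos n with rfl | hn
  · rcases Nat.eq_zero_or_pos d with rfl | hd
    · rcases Nat.eq_zero_or_pos D with rfl | hD
      · simp
      · rw [Nat.zero_pow hD]; simp; omega
    · rw [Nat.zero_pow hd, Nat.zero_pow (lt_of_lt_of_le hd h)]; omega
  · exact Nat.add_le_add (Nat.pow_le_pow_right hn h) h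

/-! ### "No witness circuits" = hard inputs at infinitely many lengths -/

/-- Unfolding of `¬ V.HasWitnessCircuits`: for every exponent `d` some `x ∈ L` has NO accepted
witness that is a prefix of the truth table of a `B₂`-circuit with `≤ |x|ᵈ + d` gates ("some
correct verifier for `NEXP` accepts witnesses that cannot be encoded with small circuits",
Williams 2010, §3, before Lemma 3.1). [cite: Williams2010STOC, §3 (before Lemma 3.1)] -/
theorem NVerifier.not_hasWitnessCircuits_iff {k : ℕ} {L : Language Bool}
    (V : NVerifier (fun n => 2 ^ (n ^ k)) L) :
    ¬ V.HasWitnessCircuits ↔ ∀ d : ℕ, ∃ x ∈ L, ∀ (m : ℕ) (W : Circuit (Fin m)) (y : List Bool),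
      W.IsOver B2 → W.size ≤ x.length ^ d + d → y.length ≤ V.c * 2 ^ (x.length ^ k) + V.c →
        V.rel x y = true → ¬ y <+: MetaComplexity.truthTable W.eval := by
  unfold NVerifier.HasWitnessCircuits
  push Not
  rfl

/-- **"No witness circuits of polynomial size" means hard inputs at infinitely many lengths.**
`¬ V.HasWitnessCircuits` iff for every `d` there are, at infinitely many lengths `n`
(`∃ᶠ n in atTop`), inputs `x ∈ L` of length `n` none of whose accepted witnesses is a prefix of
the truth table of a `B₂`-circuit with `≤ nᵈ + d` gates — Williams' "for all constants `d ≥ 1`,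
there is an infinite sequence of inputs" with hard witnesses (2010, App. A) and the hypothesis
shape of IKW's Thm. 12 (2) ("for every `d ∈ ℕ` and infinitely many `n ∈ ℕ`, `fₙ` has circuit
complexity greater than `n^d`"). (`→`: were the hard lengths for `d` bounded by `N`, the finitely
many `x ∈ L` shorter than `N` would have witness circuits of a common size `D₀` — correctness of `V`
and `exists_isPrefix_truthTable` — and the constant `max d D₀` would give `V` witness circuits;
`←`: immediate.) [cite: Williams2010STOC, Appendix A (proof of Lemma 3.1)]
[cite: ImpagliazzoKabanetsWigderson2002, Thm. 12 (2)] -/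
theorem NVerifier.not_hasWitnessCircuits_iff_frequently {k : ℕ} {L : Language Bool}
    (V : NVerifier (fun n => 2 ^ (n ^ k)) L) :
    ¬ V.HasWitnessCircuits ↔ ∀ d : ℕ, ∃ᶠ n in atTop, ∃ x ∈ L, x.length = n ∧
      ∀ (m : ℕ) (W : Circuit (Fin m)) (y : List Bool), W.IsOver B2 → W.size ≤ x.length ^ d + d →
        y.length ≤ V.c * 2 ^ (x.length ^ k) + V.c → V.rel x y = true →
          ¬ y <+: MetaComplexity.truthTable W.eval := by
  classical
  -- `Easy d x`: `x` has an accepted witness encoded by a circuit with `≤ |x|^d + d` gates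
  set Easy : ℕ → List Bool → Prop := fun d x => ∃ (m : ℕ) (W : Circuit (Fin m)) (y : List Bool),
    W.IsOver B2 ∧ W.size ≤ x.length ^ d + d ∧ y.length ≤ V.c * 2 ^ (x.length ^ k) + V.c ∧
      V.rel x y = true ∧ y <+: MetaComplexity.truthTable W.eval with hEasy
  have hmono : ∀ {d D : ℕ} (x : List Bool), d ≤ D → Easy d x → Easy D x := by
    rintro d D x hdD ⟨m, W, y, hB, hs, hy, hr, hp⟩
    exact ⟨m, W, y, hB, hs.trans (pow_add_self_mono x.length hdD), hy, hr, hp⟩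
  -- every `x ∈ L` is easy for SOME `d` (correctness + `exists_isPrefix_truthTable`)
  have hsome : ∀ x ∈ L, ∃ d, Easy d x := by
    intro x hx
    obtain ⟨y, hy, hr⟩ := (V.mem_iff x).1 hx
    obtain ⟨m, W, hB, hp⟩ := exists_isPrefix_truthTable y
    exact ⟨W.size, m, W, y, hB, Nat.le_add_left _ _, hy, hr, hp⟩
  -- restatement of both sides through `Easy`
  have hnot : ∀ (d : ℕ) (x : List Bool), (∀ (m : ℕ) (W : Circuit (Fin m)) (y : List Bool),
      W.IsOver B2 → W.size ≤ x.length ^ d + d → y.length ≤ V.c * 2 ^ (x.length ^ k) + V.c →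
        V.rel x y = true → ¬ y <+: MetaComplexity.truthTable W.eval) ↔ ¬ Easy d x := by
    intro d x
    simp only [hEasy, not_exists, not_and]
  have hHas : V.HasWitnessCircuits ↔ ∃ c, ∀ x ∈ L, Easy c x := Iff.rfl
  simp only [hnot, hHas]
  constructor
  · intro hno d
    rw [Filter.frequently_atTop]
    intro N
    by_contra hN
    push Not at hN
    -- all `x ∈ L` of length `≥ N` are easy for `d`
    have hlong : ∀ x ∈ L, N ≤ x.length → Easy d x := fun x hx hNx => hN x.length hNx x hx rfl
    -- the finitely many shorter members of `L` are easy for a common `D₀`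
    have hfin : {x : List Bool | x.length < N}.Finite := List.finite_length_lt Bool N
    set g : List Bool → ℕ := fun x => if hx : x ∈ L then Nat.find (hsome x hx) else 0 with hg
    obtain ⟨D₀, hD₀⟩ := (hfin.image g).bddAbove
    have hshort : ∀ x ∈ L, x.length < N → Easy D₀ x := by
      intro x hx hxN
      have hgx : g x ≤ D₀ := hD₀ (Set.mem_image_of_mem g hxN)
      have hfx : Easy (g x) x := by
        simp only [hg, dif_pos hx]
        exact Nat.find_spec (hsome x hx)
      exact hmono x hgx hfx
    refine hno ⟨max d D₀, fun x hx => ?_⟩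
    rcases lt_or_ge x.length N with hxN | hxN
    · exact hmono x (le_max_right _ _) (hshort x hx hxN)
    · exact hmono x (le_max_left _ _) (hlong x hx hxN)
  · rintro hfreq ⟨c, hc⟩
    obtain ⟨n, x, hx, -, hhard⟩ := (hfreq c).exists
    exact hhard (hc x hx)

/-- The derandomization leaf may therefore be fed the printed hypothesis directly: a verifier with
`d`-hard inputs at infinitely many lengths for every `d` puts `MA` inside
`io-[NTIME(2^{n^ε})/n^ε]` for every `ε > 0`. [cite: Williams2010STOC, Appendix A (proof of Lemma 3.1)] -/
theorem MA_subset_io_of_frequently_hard (hA : Williams2010_MA_io_of_not_witnessCircuits)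
    {k : ℕ} {L : Language Bool} (V : NVerifier (fun n => 2 ^ (n ^ k)) L)
    (hV : ∀ d : ℕ, ∃ᶠ n in atTop, ∃ x ∈ L, x.length = n ∧
      ∀ (m : ℕ) (W : Circuit (Fin m)) (y : List Bool), W.IsOver B2 → W.size ≤ x.length ^ d + d →
        y.length ≤ V.c * 2 ^ (x.length ^ k) + V.c → V.rel x y = true →
          ¬ y <+: MetaComplexity.truthTable W.eval)
    {ε : ℝ} (hε : 0 < ε) :
    MA ⊆ io (advice (NTIME fun n => 2 ^ ⌈(n : ℝ) ^ ε⌉₊) fun n => ⌈(n : ℝ) ^ ε⌉₊) :=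
  hA L k V (V.not_hasWitnessCircuits_iff_frequently.2 hV) ε hε

/-! ### Theorem 5.2 and Theorem 5.1 from the three remaining leaves -/

/-- **Williams 2014, Thm. 5.2 from its three remaining leaves**: `EXP ⊆ P/poly ⟹ EXP = MA`
(BFL91/BFNW93; IKW Thm. 22, `EXP_eq_MA_of_subset_PPoly`), the derandomization of `MA` from a
verifier without witness circuits (Williams 2010, App. A; IKW Thm. 12 (2) with Lemma 17,
`Williams2010_MA_io_of_not_witnessCircuits`) and IKW's Lemma 5 (`IKW2002_lemma5`, a universal
nondeterministic machine); the diagonalization `EXP ⊄ io-SIZE(n^c)` (IKW Thm. 2) is the tree's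
theorem `IKW2002_thm2_holds`. [cite: Williams2014, Thm. 5.2]
[cite: Williams2010STOC, Lemma 3.1 and Appendix A] -/
theorem Williams2014_thm_5_2_of_leaves (h22 : EXP_eq_MA_of_subset_PPoly)
    (hA : Williams2010_MA_io_of_not_witnessCircuits) (h5 : IKW2002_lemma5) :
    Williams2014_thm_5_2 :=
  Williams2014_thm_5_2_of_components h22 hA h5 IKW2002_thm2_holds

/-- **Williams 2014, Thm. 5.1 from the same three leaves** (through
`Williams2014_thm_5_1_of_components`, i.e. Thm. 5.1 from Thm. 5.2, `SuccinctWitnessesFromUWC.lean`).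
[cite: Williams2014, Thm. 5.1 and Thm. 5.2] -/
theorem Williams2014_thm_5_1_of_leaves (h22 : EXP_eq_MA_of_subset_PPoly)
    (hA : Williams2010_MA_io_of_not_witnessCircuits) (h5 : IKW2002_lemma5) :
    Williams2014_thm_5_1 :=
  Williams2014_thm_5_1_of_components h22 hA h5 IKW2002_thm2_holds

end Literature.Computability.Complexity

end
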